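/-
Copyright (c) 2026 the pub-hodgecm-mathlib formalisation cell (harness21).  Prover seat hodgecm-mathlib-R90-C10-p03 (g0) (valve hand to L1),
Track B «K2-LIT» ∕ hLiu418 #184♮ = `stmt-HodgeConjecture-24832`, socket #41 K1-b♮ ∕ (P-dec) organ — brick (ρ6a) COMPOSITION (LEAD F0P6-plan (g14) BATCH #178 (3);
K2Liu-p14 (g4) WORD #4∕#5): `hΛγ` from the three height bricks (B-i) (F0P2-p09), (B-ii) ★ p863334, (B-iii) (LH4-p10 ∕ next hand).
-/
import Summits.HodgeConjecture.HodgeConjecture.Theorems.K2LiuRowSectionHeightLeVecHeight   -- ★ p863334 (this lineage): (B-ii) `exists_adelicHeightGL_rowSection_le` + vecHeight monotonicity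
import Summits.HodgeConjecture.HodgeConjecture.Theorems.K2LiuRankOneRowSection             -- ★ p863259 (this lineage): `exists_normalised_rowSection` (the section `γ` with ★ p861327's `hγ`)
import Mathlib.NumberTheory.Height.NumberField
import HarnessLib

/-!
# K2_Liu road (hLiu418), (P-dec) organ, brick (ρ6a) — THE COMPOSITION: `‖Λ(γ[w])_𝔸‖ ≤ C · H([w])^k` from the three height bricks, hypothesis-first
# on (B-i) «Godement–Garrett vs Mathlib height» and (B-iii) «height along the Levi map»

Cell `pub/hodgecm-mathlib` (D-0151), Track B.  Lane `--kind proof --supports stmt-HodgeConjecture-24832 --as helper` (count-neutral; THEOREMS ONLY: no `def`,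
no `instance`, no notation, no named-fact hypothesis, no `sorry`).

THE LETTER p14's (P-dec) `K2LiuKindOneLineDecay` carries BY VALUE (LEAD BATCH #172 (3)): a row section `γ : ℙ(L²) → GL₂(L)` with ★ p861327's
`hγ : [row₁ (γ p)] = p` AND the height control `‖Λ(γ[w])_𝔸‖ ≤ C · Height.mulHeight w ^ k` for the Levi map `Λ`.  It is the composite of three bricks:
(B-i) `h(w_𝔸) ≤ C₁ · mulHeight w ^ k₁` (★∕📤 `K2LiuVecHeightVsMulHeight.exists_vecHeight_principalVec_le_mulHeight_pow`, F0P2-p09 — taken here HYPOTHESIS-FIRST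
in its exact head shape `hBi`); (B-ii) ★ `exists_adelicHeightGL_rowSection_le` (`‖g_𝔸‖ ≤ C₂ · h(w_𝔸)` for `g` with the entry control of the normalised section) +
★ `exists_normalised_rowSection`; (B-iii) `‖Λ g‖ ≤ C₃ · ‖g‖²` (`K2LiuLeviHomHeightBound`, LH4-p10 ∕ next hand — taken HYPOTHESIS-FIRST as `hΛ` for ANY map
`Λ : GL₂(𝔸_L) → GL_m(𝔸_L)`, so the consumer instantiates `Λ := fun g => (Λhom g : GL (Fin (2+2)) 𝔸_L)` at ★ `exists_leviHom_blk_eq`'s hom).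
* **`hΛγ_of_heightBricks (hBi) (Λ) (hΛ) : ∃ γ C k, 0 ≤ C ∧ (∀ p, mk ((γ p) 1) _ = p) ∧ ∀ w ≠ 0, ‖Λ (γ[w])_𝔸‖ ≤ C · mulHeight w ^ k`** with `C = C₃ (C₂ C₁)²`, `k = 2k₁`.
HONEST LABEL: HC_CM is proved only modulo the 7 printed citations (2 remaining named inputs: hLiu418 = `stmt-HodgeConjecture-24832`, h413 =
`stmt-HodgeConjecture-24833`) until rung 0 closes; this helper closes nothing and moves no counter — it turns p14's `hΛγ` into the two named letters (B-i), (B-iii).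
References: [BorelJacquet1979] §1.2; [Garrett2018] §2.2; [MoeglinWaldspurger1995] I.2.2, II.1.7.
-/

set_option autoImplicit false
set_option linter.dupNamespace false -- the mandated namespace repeats `HodgeConjecture.HodgeConjecture`

noncomputable section

open scoped NNReal MatrixGroups
open NumberField IsDedekindDomain

namespace Summit.HodgeConjecture.HodgeConjecture.Cruxes.HLiu418.K2LiuKindOneLineLeviRowHeight

open Literature.NumberTheory.Automorphic
open Summit.HodgeConjecture.HodgeConjecture.Cruxes.HLiu418.K2LiuSiegelMiddleCellLeviCriterion (row_ne_zero)
open Summit.HodgeConjecture.HodgeConjecture.Cruxes.HLiu418.K2LiuRankOneRowSection (exists_normalised_rowSection)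
open Summit.HodgeConjecture.HodgeConjecture.Cruxes.HLiu418.K2LiuRowSectionHeightLeVecHeight (exists_adelicHeightGL_rowSection_le)

variable (L : Type) [Field L] [NumberField L]

/-- **(ρ6a) COMPOSED: a row section `γ` with ★ p861327's `hγ` and `‖Λ(γ[w])_𝔸‖ ≤ C · H(w)^k`** — from (B-i) `h(w_𝔸) ≤ C₁ H(w)^{k₁}` (hypothesis `hBi`, F0P2-p09's
head shape), (B-ii) ★ `exists_adelicHeightGL_rowSection_le` ∘ ★ `exists_normalised_rowSection`, and (B-iii) `‖Λ g‖ ≤ C₃ ‖g‖²` (hypothesis `hΛ`, any map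
`Λ : GL₂(𝔸_L) → GL_m(𝔸_L)`): `‖Λ(γ[w])_𝔸‖ ≤ C₃ (C₂ C₁ H(w)^{k₁})² = C₃ (C₂ C₁)² · H(w)^{2k₁}`. [cite: BorelJacquet1979, §1.2] [cite: Garrett2018, §2.2 (PDF p. 81)] -/
theorem hΛγ_of_heightBricks {m : ℕ}
    (hBi : ∃ C : ℝ, ∃ k : ℕ, 0 ≤ C ∧ ∀ ξ : Fin 2 → L, ξ ≠ 0 → ((vecHeight L (principalVec L ξ) : ℝ≥0) : ℝ) ≤ C * Height.mulHeight ξ ^ k)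
    (Λ : GL (Fin 2) (AdeleRing (𝓞 L) L) → GL (Fin m) (AdeleRing (𝓞 L) L))
    (hΛ : ∃ C : ℝ, 0 ≤ C ∧ ∀ g : GL (Fin 2) (AdeleRing (𝓞 L) L), adelicHeightGL m L (Λ g) ≤ C * adelicHeightGL 2 L g ^ 2) :
    ∃ (γ : Projectivization L (Fin 2 → L) → GL (Fin 2) L) (C : ℝ) (k : ℕ), 0 ≤ C ∧
      (∀ p, Projectivization.mk L ((γ p : Matrix (Fin 2) (Fin 2) L) 1) (row_ne_zero (γ p) 1) = p) ∧
      ∀ (w : Fin 2 → L) (hw : w ≠ 0),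
        adelicHeightGL m L (Λ (Matrix.GeneralLinearGroup.map (algebraMap L (AdeleRing (𝓞 L) L)) (γ (Projectivization.mk L w hw)))) ≤
          C * Height.mulHeight w ^ k := by
  obtain ⟨γ, hγ, hnorm⟩ := exists_normalised_rowSection (K := L)
  obtain ⟨C₁, k₁, hC₁, hBi⟩ := hBi
  obtain ⟨C₂, hC₂, hBii⟩ := exists_adelicHeightGL_rowSection_le L
  obtain ⟨C₃, hC₃, hΛ⟩ := hΛ
  refine ⟨γ, C₃ * (C₂ * C₁) ^ 2, 2 * k₁, by positivity, hγ, fun w hw => ?_⟩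
  obtain ⟨i, hi, -, hent⟩ := hnorm w hw
  set g : GL (Fin 2) L := γ (Projectivization.mk L w hw) with hg
  -- (B-ii) ∘ (B-i): `‖g_𝔸‖ ≤ C₂ h(w_𝔸) ≤ C₂ C₁ H(w)^{k₁}`
  have h12 : adelicHeightGL 2 L (Matrix.GeneralLinearGroup.map (algebraMap L (AdeleRing (𝓞 L) L)) g) ≤ C₂ * C₁ * Height.mulHeight w ^ k₁ :=
    calc adelicHeightGL 2 L (Matrix.GeneralLinearGroup.map (algebraMap L (AdeleRing (𝓞 L) L)) g)
        ≤ C₂ * ((vecHeight L (principalVec L w) : ℝ≥0) : ℝ) := hBii w i hi g hent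
      _ ≤ C₂ * (C₁ * Height.mulHeight w ^ k₁) := mul_le_mul_of_nonneg_left (hBi w hw) hC₂
      _ = C₂ * C₁ * Height.mulHeight w ^ k₁ := by ring
  -- (B-iii): square it
  have h0 : 0 ≤ adelicHeightGL 2 L (Matrix.GeneralLinearGroup.map (algebraMap L (AdeleRing (𝓞 L) L)) g) := adelicHeightGL_nonneg _
  calc adelicHeightGL m L (Λ (Matrix.GeneralLinearGroup.map (algebraMap L (AdeleRing (𝓞 L) L)) g))
      ≤ C₃ * adelicHeightGL 2 L (Matrix.GeneralLinearGroup.map (algebraMap L (AdeleRing (𝓞 L) L)) g) ^ 2 := hΛ _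
    _ ≤ C₃ * (C₂ * C₁ * Height.mulHeight w ^ k₁) ^ 2 := mul_le_mul_of_nonneg_left (pow_le_pow_left₀ h0 h12 2) hC₃
    _ = C₃ * (C₂ * C₁) ^ 2 * Height.mulHeight w ^ (2 * k₁) := by ring

end Summit.HodgeConjecture.HodgeConjecture.Cruxes.HLiu418.K2LiuKindOneLineLeviRowHeight

end
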